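import Mathlib
import Summits.ResolutionOfSingularities.ResolutionOfSingularities.Theorems.WeightedInvariantLocalWeightedDropNCResSurfGraphPointClause
import Summits.ResolutionOfSingularities.ResolutionOfSingularities.Theorems.WeightedInvariantLocalWeightedDropNCResSurfGraphEntry
import Summits.ResolutionOfSingularities.ResolutionOfSingularities.Theorems.WeightedInvariantLocalWeightedDropNCDirectrixCutHist

/-!
# `WeightedInvariant.LocalWeightedDrop`: NC-resolution settings for the TOT₂ line — GRAPH SURFACES, part 17: THE SURFACE REGIME of the line stub
# `ApexPlaneExit` (the proposed re-cut `PL = Surface ∧ Low`) and its reduction to the graph-surface loop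

Crux item stmt-ResolutionOfSingularities-8899 `LocalWeightedDrop` (route `ResolutionOfSingularities/WeightedInvariant`), ENGINE skeleton v32/v33, residuals
`stub_spaceNCRankDrop` / `stub_wildWideApexFourStartsWon` (res-L1-w43-strat-1's line `directrix-cut` v3.1, piece PL = `ApexPlaneExit`; S-E2-SURF design memo
`L/res-L1-w43-stub-4/g5/S-E2-SURF.md`).  [OURS · L1 W4.3 · chain w43 · seat res-L1-w43-stub-4 gen 5; two definitions (`ApexPlaneSurfaceExit`, `SurfLoop`)
stating the surface sub-regime and the loop obligation; nothing here is a statement of any manuscript; AI-produced, gate-checked, weaker than expert review.]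

* `ApexPlaneSurfaceExit k m` — THE SURFACE SUB-CASE of `ApexPlaneExit` (…NCDirectrixCutHist): from an admissibly decorated `(b, δ)` with `o ≥ 2`,
  apex dimension `≤ 2`, and a LEGAL `Φ` with `Φ^* g ∈ (x_j : j ∉ {a′, b′})^c` (the `c`-fold locus contains a smooth surface tangent to the directrix),
  the mover forces «NC, or admissibly decorated of smaller head»;
* `SurfLoop k m` — THE LOOP OBLIGATION: from every admissibly decorated `SurfState` the mover forces «admissibly decorated of smaller head»;
* `surfState_of_legal` — the ENTRY (part 4's bridge): the hypotheses of `ApexPlaneSurfaceExit` put `δ` in `SurfState`;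
* **`apexPlaneSurfaceExit_of_surfLoop`** — `SurfLoop k m → ApexPlaneSurfaceExit k m`.  What remains for the surface sub-case is exactly `SurfLoop`
  (parts 15–16 give its two move clauses; memo §5–§8 the measure still to be built).
-/

set_option linter.dupNamespace false -- mandated namespace of this single-conjunct summit

noncomputable section

namespace Summit.ResolutionOfSingularities.ResolutionOfSingularities.Theorems

namespace TameFourTupleDrop

open MvPowerSeries Literature.AlgebraicGeometry.Resolution GraphSurf

variable {k : Type} [Field k] {m : ℕ}

/-- THE SURFACE SUB-CASE OF THE LINE STUB `ApexPlaneExit` (proposed re-cut `ApexPlaneExit ⟸ ApexPlaneSurfaceExit ∧ ApexPlaneLowExit`). [OURS] -/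
def ApexPlaneSurfaceExit (k : Type) [Field k] (m : ℕ) : Prop :=
  ∀ (b : MvPowerSeries (Fin (m + 1)) k) (δ : Decoration k m), Admissible b δ → 2 ≤ δ.o →
    (∀ u₁ u₂ u₃ : Fin (m + 1) → k,
      (∀ v, CobordantChart.initEval (fun _ : Fin (m + 1) => 1) (v + u₁) δ.c (δ.f * ∏ l ∈ δ.O, X l) =
        CobordantChart.initEval (fun _ : Fin (m + 1) => 1) v δ.c (δ.f * ∏ l ∈ δ.O, X l)) →
      (∀ v, CobordantChart.initEval (fun _ : Fin (m + 1) => 1) (v + u₂) δ.c (δ.f * ∏ l ∈ δ.O, X l) =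
        CobordantChart.initEval (fun _ : Fin (m + 1) => 1) v δ.c (δ.f * ∏ l ∈ δ.O, X l)) →
      (∀ v, CobordantChart.initEval (fun _ : Fin (m + 1) => 1) (v + u₃) δ.c (δ.f * ∏ l ∈ δ.O, X l) =
        CobordantChart.initEval (fun _ : Fin (m + 1) => 1) v δ.c (δ.f * ∏ l ∈ δ.O, X l)) →
      ∃ α β γ : k, (α ≠ 0 ∨ β ≠ 0 ∨ γ ≠ 0) ∧ α • u₁ + β • u₂ + γ • u₃ = 0) →
    (∃ (Φ : Fin (m + 1) → MvPowerSeries (Fin (m + 1)) k) (a' b' : Fin (m + 1)), (∀ l, constantCoeff (Φ l) = 0) ∧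
      IsUnit (Matrix.det (Matrix.of fun i j : Fin (m + 1) => coeff (Finsupp.single j 1) (Φ i))) ∧ a' ≠ b' ∧
      InOffPlaneIdeal a' b' δ.c (subst Φ (δ.f * ∏ l ∈ δ.O, X l))) →
    DWinsTo (St := MvPowerSeries (Fin (m + 1)) k × Decoration k m) Prod.fst
      (fun τ => GermIsNC τ.1 ∨ (Admissible τ.1 τ.2 ∧ τ.2.head < δ.head)) (b, δ)

/-- THE LOOP OBLIGATION OF S-E2-SURF: from every admissibly decorated `SurfState` the mover forces a smaller head. [OURS] -/
def SurfLoop (k : Type) [Field k] (m : ℕ) : Prop :=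
  ∀ (b : MvPowerSeries (Fin (m + 1)) k) (δ : Decoration k m), Admissible b δ → SurfState δ →
    DWinsTo (St := MvPowerSeries (Fin (m + 1)) k × Decoration k m) Prod.fst (fun τ => Admissible τ.1 τ.2 ∧ τ.2.head < δ.head) (b, δ)

/-- **THE ENTRY**: a legal `Φ` with `Φ^* g ∈ (x_j : j ∉ {a′,b′})^c` and apex dimension `≤ 2` put `δ` in `SurfState` (part 4's bridge). -/
theorem surfState_of_legal {δ : Decoration k m}
    (htwo : ∀ u₁ u₂ u₃ : Fin (m + 1) → k,
      (∀ v, CobordantChart.initEval (fun _ : Fin (m + 1) => 1) (v + u₁) δ.c (δ.f * ∏ l ∈ δ.O, X l) =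
        CobordantChart.initEval (fun _ : Fin (m + 1) => 1) v δ.c (δ.f * ∏ l ∈ δ.O, X l)) →
      (∀ v, CobordantChart.initEval (fun _ : Fin (m + 1) => 1) (v + u₂) δ.c (δ.f * ∏ l ∈ δ.O, X l) =
        CobordantChart.initEval (fun _ : Fin (m + 1) => 1) v δ.c (δ.f * ∏ l ∈ δ.O, X l)) →
      (∀ v, CobordantChart.initEval (fun _ : Fin (m + 1) => 1) (v + u₃) δ.c (δ.f * ∏ l ∈ δ.O, X l) =
        CobordantChart.initEval (fun _ : Fin (m + 1) => 1) v δ.c (δ.f * ∏ l ∈ δ.O, X l)) →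
      ∃ α β γ : k, (α ≠ 0 ∨ β ≠ 0 ∨ γ ≠ 0) ∧ α • u₁ + β • u₂ + γ • u₃ = 0)
    (hlegal : ∃ (Φ : Fin (m + 1) → MvPowerSeries (Fin (m + 1)) k) (a' b' : Fin (m + 1)), (∀ l, constantCoeff (Φ l) = 0) ∧
      IsUnit (Matrix.det (Matrix.of fun i j : Fin (m + 1) => coeff (Finsupp.single j 1) (Φ i))) ∧ a' ≠ b' ∧
      InOffPlaneIdeal a' b' δ.c (subst Φ (δ.f * ∏ l ∈ δ.O, X l))) :
    SurfState δ := by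
  obtain ⟨a, b, ψ, hab, hψ, -, -, hperm⟩ := exists_graph_of_legal_inOffPlaneIdeal hlegal
  exact ⟨⟨a, b, ψ, hab, fun j _ => hψ j, hperm⟩, htwo⟩

/-- **THE SURFACE SUB-CASE REDUCES TO THE LOOP**: `SurfLoop k m → ApexPlaneSurfaceExit k m`. -/
theorem apexPlaneSurfaceExit_of_surfLoop (hloop : SurfLoop k m) : ApexPlaneSurfaceExit k m := by
  intro b δ hadm _ htwo hlegal
  exact (hloop b δ hadm (surfState_of_legal htwo hlegal)).mono fun τ hτ => Or.inr hτ

end TameFourTupleDrop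

end Summit.ResolutionOfSingularities.ResolutionOfSingularities.Theorems

end
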